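import Summits.PneNP.PneNP.Theorems.ReslinMediumCoverManyMediumLinesBoundaryLaw
import Summits.PneNP.PneNP.Theorems.ReslinMediumCoverManyMediumLinesCritAt

/-!
# PneNP / ReslinMediumCover — rank lower bound for Res(⊕) refutations of `τ(G, c) ∘ MAJ₃` over a
medium-expander, with the route's hypotheses only (crux `ManyMediumLines`, stmt-PneNP-19698)

Route `PneNP/ReslinMediumCover`, crux `Summit.PneNP.PneNP.Theses.ReslinMediumCover.ManyMediumLines`
(open problem; NOT claimed). The rank corollary of the boundary law
(`ResLinBoundaryLaw.lt_resLinWidth_of_isResLinRefutation`) under exactly the hypotheses of the crux: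
`G` connected, odd charge (whence every vertex has a critical assignment,
`critAt_nonempty_of_connected`), `N ≥ 24`, and every medium vertex set with more than `r` boundary
edges — then every dag-like Res(⊕) refutation of `tseitinMaj G c` (semantic weakening) has a line of
rank `> r + 1`. With the crux's expansion hypothesis `ηN ≤ |∂U|` this gives rank `> ⌈ηN⌉`
(`exists_rank_gt_of_expansion`). A Res(⊕) width (= rank) bound for 1-stifling lifts of CNFs of large
resolution width is Alekseev–Itsykson (STOC 2025); this is an independent kernel-checked proof for the
lifted Tseitin formula of the route, NOT a new bound, and NOT a size bound.

References: Y. Alekseev, D. Itsykson, STOC 2025 (width lifting via games); K. Efremenko, D. Itsykson,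
CCC 2025, Thm 1 (statement of the former); S. Jukna, *Boolean Function Complexity* (2012), Thm 18.17.
-/

namespace Summit.PneNP.PneNP.Theorems

-- `Summit.PneNP.PneNP` repeats a path component by design (summit = sub-problem); silence the linter.
set_option linter.dupNamespace false

namespace ResLinBoundaryLaw

open Finset Literature.Computability.Complexity Literature.Computability.MetaComplexity

variable {N : ℕ} (G : SimpleGraph (Fin N)) [DecidableRel G.Adj] (c : Fin N → Bool)

/-- **Rank lower bound under the route's hypotheses**: `G` connected on `N ≥ 24` vertices, odd charge,
every medium vertex set (`⌈N/8⌉ < |U| < N - ⌈N/8⌉`) with more than `r` boundary edges ⇒ every Res(⊕)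
refutation of `τ(G, c) ∘ MAJ₃` has a line of rank `> r + 1`. -/
theorem exists_rank_gt_of_connected (hN : 24 ≤ N) (hG : G.Connected)
    (hodd : Odd (Finset.univ.filter fun u => c u = true).card) (r : ℕ)
    (hexp : ∀ U : Finset (Fin N), (N + 7) / 8 < U.card → U.card + (N + 7) / 8 < N →
      r < (edgeCut G U).card)
    (π : List ResLinLine) (hπ : IsResLinRefutation (tseitinMaj G c) π) :
    ∃ l ∈ π, r + 1 < linClauseRank l.clause :=
  exists_lt_linClauseRank_of_isResLinRefutation G c hN (critAt_nonempty_of_connected G c hG hodd) r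
    hexp π hπ

/-- The same, in terms of the width (maximal line rank) of the refutation. -/
theorem lt_resLinWidth_of_connected (hN : 24 ≤ N) (hG : G.Connected)
    (hodd : Odd (Finset.univ.filter fun u => c u = true).card) (r : ℕ)
    (hexp : ∀ U : Finset (Fin N), (N + 7) / 8 < U.card → U.card + (N + 7) / 8 < N →
      r < (edgeCut G U).card)
    (π : List ResLinLine) (hπ : IsResLinRefutation (tseitinMaj G c) π) :
    r + 1 < resLinWidth π :=
  lt_resLinWidth_of_isResLinRefutation G c hN (critAt_nonempty_of_connected G c hG hodd) r hexp π hπ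

/-- **Rank lower bound in the crux's own terms**: with the real expansion hypothesis of
`ManyMediumLines` (`η · N ≤ |edgeCut G U|` for every medium `U`, `η > 1`), every Res(⊕) refutation of
`τ(G, c) ∘ MAJ₃` (connected `G`, `N ≥ 24`, odd charge) has a line whose rank exceeds `η · N` — indeed
exceeds `⌊η N⌋ + 1`. -/
theorem exists_rank_gt_of_expansion (η : ℝ) (hη : 1 < η) (hN : 24 ≤ N) (hG : G.Connected)
    (hexp : ∀ U : Finset (Fin N), (N + 7) / 8 < U.card → U.card + (N + 7) / 8 < N →
      η * N ≤ ((edgeCut G U).card : ℝ))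
    (hodd : Odd (Finset.univ.filter fun u => c u = true).card)
    (π : List ResLinLine) (hπ : IsResLinRefutation (tseitinMaj G c) π) :
    ∃ l ∈ π, η * N < (linClauseRank l.clause : ℝ) := by
  -- `r := ⌊η N⌋₊ - 1` boundary edges are exceeded by every medium set
  have hηN : (1 : ℝ) ≤ η * N := by
    have : (24 : ℝ) ≤ N := by exact_mod_cast hN
    nlinarith
  set r : ℕ := ⌊η * N⌋₊ - 1 with hr
  have hr1 : 1 ≤ ⌊η * N⌋₊ := by
    rw [Nat.one_le_floor_iff]
    exact hηN
  have hexp' : ∀ U : Finset (Fin N), (N + 7) / 8 < U.card → U.card + (N + 7) / 8 < N →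
      r < (edgeCut G U).card := by
    intro U h1 h2
    have h := hexp U h1 h2
    have hfloor : ⌊η * N⌋₊ ≤ (edgeCut G U).card := Nat.floor_le_of_le h
    omega
  obtain ⟨l, hl, hlt⟩ := exists_rank_gt_of_connected G c hN hG hodd r hexp' π hπ
  refine ⟨l, hl, ?_⟩
  have h1 : ⌊η * N⌋₊ < linClauseRank l.clause := by omega
  exact (Nat.lt_floor_add_one (η * N)).trans_le (by exact_mod_cast h1)

end ResLinBoundaryLaw

end Summit.PneNP.PneNP.Theorems
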